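/-
Copyright (c) 2026. All rights reserved.
Released under Apache 2.0 license as described in the file LICENSE.
Authors: abc-iut cell, discharge seat abc-iut-w4-d020 (gen 8; L-F rows F-0155/F-0156 of [AbsTopIII] Cor 5.5 (v) at the
settings with genuine components of abc-iut-w4-d095).
-/
import Literature.AnabelianGeometry.AbsoluteAnabelian.LogFrobeniusMonoGenuineModel
import Literature.AnabelianGeometry.AbsoluteAnabelian.LogFrobeniusRigidity
import Literature.AnabelianGeometry.AbsoluteAnabelian.AbsTopIII.AutHolLogFrobeniusNexusRigidityProofs
import Literature.AnabelianGeometry.AbsoluteAnabelian.AbsTopIII.BiAnabelianModelNonRigidity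
import Literature.AnabelianGeometry.AbsoluteAnabelian.ArchimedeanHolFieldFunctorGeometricOverIdRigid
import Literature.AnabelianGeometry.AbsoluteAnabelian.ArchimedeanHolFieldFunctorGeometricCarriersProofs
import Literature.AnabelianGeometry.AbsoluteAnabelian.AbsTopIII.AutHolLogFrobeniusGaloisModel
import Literature.AnabelianGeometry.AbsoluteAnabelian.AbsTopIII.AutHolLogFrobeniusGaloisCenterFree
import HarnessLib

/-!
# [AbsTopIII] Cor 5.5 (v), total `□`-rigidity (FACT-LIST F-0155 `Cor55CoreRigid`, F-0156 `Cor55Rigidity`) at the settings with GENUINE components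

S. Mochizuki, *Topics in absolute anabelian geometry III* [MochizukiAbsTopIII2015], Cor 5.5 (v) p. 131 (own read
of the manuscript render `AbsTopIII-kurims-url-5493eb38cbb7`, p0131): "`D•` is totally `□`-rigid" (Def 3.5 (vi)),
proof p. 133: reduced to the id-rigidity of `𝒳 = Th•_T[Z]` (Prop 3.2 (iv)).  abc-iut-L4-t3 typed the clause as the
named hypothesis `LogFrobeniusSetting.Cor55CoreRigid` (F-0155; with the `ℤ`-action clause F-0157 conjoined: F-0156
`Cor55Rigidity`); abc-iut-w5-d112 reduced it, for EVERY setting `L`, to `IsIdRigid L.X` (`cor55CoreRigid_iff`).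

PROOF-ONLY (no `def`, nothing restated).  The cell's L-F programme (HOME/plan/L4/LF-ABSTOP.tsv rows F-0155–F-0157,
L4-lead GO m26 2026-08-26T14:14:55Z) asks for the instances at the §5 settings of the tree carrying GENUINE components
(all three by abc-iut-w4-d095): `archGenuine 𝔄` (`𝒳 := 𝒞^hol_TF` over an Aut-holomorphic field functor `𝔄`, genuine
archimedean `ℰ•`, `An•`, `λ⊞`, `ι⊞`), `nonarchGenuine p` and `nonarchGenuineMono p` (`𝒳 := ` the MLF-Galois `TF`
model `TFModel p`, genuine nonarchimedean `λ⊞`, `ι⊞`).  All three lift their model categories one universe with `Up`.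

* `isIdRigid_up_iff` — `Up C` is equivalent to `C`, so id-rigid iff `C` is (abc-iut-L4-t12's universe-heterogeneous
  `isIdRigid_iff_of_equivalence_univ`).
* `archGenuine_cor55CoreRigid_iff` — **F-0155 at `archGenuine 𝔄` ⟺ `IsIdRigid 𝔄.EA`** (abc-iut-L4-t10/t14's
  `HolTFPair.isIdRigid_iff_isIdRigid_EA`, Prop 4.2 (i)); hence **PROVED at the genuine geometric carrier**
  `𝔄 = geometricAutHolFieldFunctor {ℂ, ℂˣ, 𝔻}` (`HolRS.isIdRigid_EA_carriers`): `archGenuine_carriers_cor55CoreRigid`.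
* v2: `archGenuine_ofGaloisCategory_cor55CoreRigid_iff` — at the Galois-category carrier `EA = B(Π)` F-0155 ⟺ `Π`
  centre-free (PROVED for slim `Π`, REFUTED for `Π` with non-trivial centre).
* `nonarchGenuine_not_cor55CoreRigid`, `nonarchGenuineMono_not_cor55CoreRigid` — **F-0155 is REFUTED at both genuine
  nonarchimedean settings**: their `𝒳` is the bare `TF` model, which is NOT id-rigid (abc-iut-L4-t9's
  `TFModel.not_isIdRigid`, the sign twist); print's `𝒳 = Th•_T[Z]` is id-rigid by Prop 3.2 (iv) — in the tree at the
  SLIM sub-model (`TFModel.isIdRigid_slim`), which these settings do not use.  Consequently F-0156 is REFUTED there too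
  (`…_not_cor55Rigidity`), and at `archGenuine` F-0156 ⟺ `IsIdRigid 𝔄.EA ∧` F-0157 (`archGenuine_cor55Rigidity_iff`).

HONEST FRAMING: instance at a model ≠ the printed theorem; the refutations concern the cell's PLACEHOLDER choice
`𝒳 := TFModel p` (all `TF`-pairs), not print's Prop 3.2 (iv).  Classical, refereed material; nothing here bears on
[IUTchIII] Cor. 3.12; no side taken; typed ≠ proved.
-/

set_option autoImplicit false

universe u

open CategoryTheory

namespace Literature.AnabelianGeometry.AbsoluteAnabelian

open AbsTopIII

/-! ## `Up` preserves and reflects id-rigidity -/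

section UpRigid

variable (C : Type (u + 1)) [Category.{u + 1} C]

/-- The forgetful functor `Up C ⥤ C` is essentially surjective (it is surjective on objects). [folklore] -/
private theorem up_essSurj : (inducedFunctor (ULift.down : ULift.{u + 2} C → C)).EssSurj :=
  ⟨fun Y => ⟨ULift.up Y, ⟨Iso.refl _⟩⟩⟩

/-- **`Up C` is id-rigid iff `C` is** (§0 p. 27 "id-rigid"; `Up C ⥤ C` is fully faithful and surjective on
objects, hence an equivalence, and id-rigidity is invariant under equivalences across universes).
[cite: MochizukiAbsTopIII2015, Section 0 p.27] -/
theorem isIdRigid_up_iff : IsIdRigid (Up C) ↔ IsIdRigid C := by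
  haveI := up_essSurj C
  haveI : (inducedFunctor (ULift.down : ULift.{u + 2} C → C)).IsEquivalence := {}
  exact isIdRigid_iff_of_equivalence_univ (inducedFunctor (ULift.down : ULift.{u + 2} C → C)).asEquivalence

end UpRigid

namespace LogFrobeniusSetting

/-! ## F-0155 / F-0156 at the setting with genuine archimedean components -/

section Arch

variable (𝔄 : AutHolFieldFunctor.{u}) (Vmod : Type (u + 1)) (isArc : Vmod → Bool)

/-- **F-0155 at `archGenuine 𝔄`**: `D•` of the archimedean-genuine setting is totally `□`-rigid iff the category
`EA` of `𝔄` is id-rigid (`𝒳 = 𝒞^hol_TF` is id-rigid iff `EA` is, Prop 4.2 (i); `cor55CoreRigid_iff`).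
[cite: MochizukiAbsTopIII2015, Cor 5.5 (v) p. 131] -/
theorem archGenuine_cor55CoreRigid_iff : (archGenuine 𝔄 Vmod isArc).Cor55CoreRigid ↔ IsIdRigid 𝔄.EA :=
  (archGenuine 𝔄 Vmod isArc).cor55CoreRigid_iff.trans
    ((isIdRigid_up_iff (HolTFPair 𝔄)).trans (HolTFPair.isIdRigid_iff_isIdRigid_EA 𝔄))

/-- F-0155 at `archGenuine 𝔄` from the id-rigidity of `EA`. [cite: MochizukiAbsTopIII2015, Cor 5.5 (v) p. 131] -/
theorem archGenuine_cor55CoreRigid_of_isIdRigid_EA (h : IsIdRigid 𝔄.EA) :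
    (archGenuine 𝔄 Vmod isArc).Cor55CoreRigid :=
  (archGenuine_cor55CoreRigid_iff 𝔄 Vmod isArc).mpr h

/-- **F-0156 at `archGenuine 𝔄`** reduces to `IsIdRigid EA` and the `ℤ`-action clause F-0157.
[cite: MochizukiAbsTopIII2015, Cor 5.5 (v) p. 131] -/
theorem archGenuine_cor55Rigidity_iff :
    (archGenuine 𝔄 Vmod isArc).Cor55Rigidity ↔ IsIdRigid 𝔄.EA ∧ (archGenuine 𝔄 Vmod isArc).Cor55ShiftAction :=
  and_congr_left' (archGenuine_cor55CoreRigid_iff 𝔄 Vmod isArc)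

end Arch

/-- **F-0155 PROVED at the genuine geometric archimedean carrier** `{ℂ, ℂˣ, 𝔻}`: `D•` of
`archGenuine (geometricAutHolFieldFunctor {ℂ, ℂˣ, 𝔻})` is totally `□`-rigid (`EA^hol` on the three carriers is id-rigid,
abc-iut-L4-t12's `HolRS.isIdRigid_EA_carriers`). [cite: MochizukiAbsTopIII2015, Cor 5.5 (v) p. 131] -/
theorem archGenuine_carriers_cor55CoreRigid (Vmod : Type 1) (isArc : Vmod → Bool) :
    (archGenuine (HolRS.geometricAutHolFieldFunctor
        (fun X : HolRS => X = HolRS.complexPlane ∨ X = HolRS.puncturedPlane ∨ X = HolRS.disc)) Vmod isArc).Cor55CoreRigid :=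
  archGenuine_cor55CoreRigid_of_isIdRigid_EA _ Vmod isArc HolRS.isIdRigid_EA_carriers

/-! ## F-0155 / F-0156 REFUTED at the settings with genuine nonarchimedean components -/

section Nonarch

variable (p : ℕ) [Fact p.Prime] (Vmod : Type 1) (isArc : Vmod → Bool)

/-- **F-0155 is REFUTED at `nonarchGenuine p`**: its `𝒳` is (the lift of) the full `TF` model `TFModel p`, which is
not id-rigid (`TFModel.not_isIdRigid`), so `D•` is not totally `□`-rigid there (`cor55CoreRigid_iff`).
[cite: MochizukiAbsTopIII2015, Cor 5.5 (v) p. 131] -/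
theorem nonarchGenuine_not_cor55CoreRigid : ¬ (nonarchGenuine p Vmod isArc).Cor55CoreRigid := fun h =>
  TFModel.not_isIdRigid p ((isIdRigid_up_iff (TFModel p)).mp ((nonarchGenuine p Vmod isArc).cor55CoreRigid_iff.mp h))

/-- Hence **F-0156 is REFUTED at `nonarchGenuine p`** (its first conjunct fails).
[cite: MochizukiAbsTopIII2015, Cor 5.5 (v) p. 131] -/
theorem nonarchGenuine_not_cor55Rigidity : ¬ (nonarchGenuine p Vmod isArc).Cor55Rigidity := fun h =>
  nonarchGenuine_not_cor55CoreRigid p Vmod isArc h.1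

/-- **F-0155 is REFUTED at `nonarchGenuineMono p`** (same `𝒳 := Up (TFModel p)`).
[cite: MochizukiAbsTopIII2015, Cor 5.5 (v) p. 131] -/
theorem nonarchGenuineMono_not_cor55CoreRigid : ¬ (nonarchGenuineMono p Vmod isArc).Cor55CoreRigid := fun h =>
  TFModel.not_isIdRigid p
    ((isIdRigid_up_iff (TFModel p)).mp ((nonarchGenuineMono p Vmod isArc).cor55CoreRigid_iff.mp h))

/-- Hence **F-0156 is REFUTED at `nonarchGenuineMono p`**. [cite: MochizukiAbsTopIII2015, Cor 5.5 (v) p. 131] -/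
theorem nonarchGenuineMono_not_cor55Rigidity : ¬ (nonarchGenuineMono p Vmod isArc).Cor55Rigidity := fun h =>
  nonarchGenuineMono_not_cor55CoreRigid p Vmod isArc h.1

end Nonarch

/-! ## v2 (append-only): the archimedean Galois-category carrier — F-0155 ⟺ `Π` centre-free -/

open Literature.AlgebraicGeometry.Frobenioids (BCat IsSlimGroup) in
/-- **F-0155 at `archGenuine (ofGaloisCategory Π)` ⟺ `Z(Π) = 1`**: at abc-iut-L4-t10's Galois-category instance of the
Aut-holomorphic field functor (`EA := B(Π)`, finite continuous `Π`-sets of a profinite group `Π` = the finite étale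
coverings of one core, hom-types lifted), `D•` of the archimedean-genuine setting is totally `□`-rigid iff `Π` is
CENTRE-FREE (abc-iut-w6-d025's `isIdRigid_bCat_iff_center_eq_bot`; print, proof of Prop 4.2 (i) p. 106: "the
id-rigidity of `EA` follows immediately from the slimness assertion of Lemma 4.3").  So F-0155 genuinely depends on the
carrier: PROVED for centre-free `Π` (e.g. slim: arithmetic fundamental groups of hyperbolic orbicurves), REFUTED for any
`Π` with non-trivial centre. [cite: MochizukiAbsTopIII2015, Cor 5.5 (v) p. 131] -/
theorem archGenuine_ofGaloisCategory_cor55CoreRigid_iff (G : Type) [Group G] [TopologicalSpace G]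
    [IsTopologicalGroup G] [CompactSpace G] [TotallyDisconnectedSpace G] (Vmod : Type 1) (isArc : Vmod → Bool) :
    (archGenuine (AutHolFieldFunctor.ofGaloisCategory G) Vmod isArc).Cor55CoreRigid ↔ Subgroup.center G = ⊥ :=
  (archGenuine_cor55CoreRigid_iff _ Vmod isArc).trans
    ((isIdRigid_uLiftHom_iff (C := BCat G)).trans isIdRigid_bCat_iff_center_eq_bot)

open Literature.AlgebraicGeometry.Frobenioids (IsSlimGroup) in
/-- F-0155 PROVED at the archimedean Galois-category carrier of a SLIM profinite group (Lemma 4.3 ⇒ Prop 4.2 (i):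
`isIdRigid_EA_ofGaloisCategory`). [cite: MochizukiAbsTopIII2015, Cor 5.5 (v) p. 131] -/
theorem archGenuine_ofGaloisCategory_cor55CoreRigid_of_isSlimGroup (G : Type) [Group G] [TopologicalSpace G]
    [IsTopologicalGroup G] [CompactSpace G] [T2Space G] [TotallyDisconnectedSpace G] (hG : IsSlimGroup G)
    (Vmod : Type 1) (isArc : Vmod → Bool) :
    (archGenuine (AutHolFieldFunctor.ofGaloisCategory G) Vmod isArc).Cor55CoreRigid :=
  archGenuine_cor55CoreRigid_of_isIdRigid_EA _ Vmod isArc (AutHolFieldFunctor.isIdRigid_EA_ofGaloisCategory hG)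

end LogFrobeniusSetting

end Literature.AnabelianGeometry.AbsoluteAnabelian
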